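import Summits.BirchSwinnertonDyer.BirchSwinnertonDyer.Theorems.ErratumRoadFiveNonSurjCornerLower
import Summits.BirchSwinnertonDyer.Rank1Residual.X11a.Cells
import HarnessLib

/-!
# Route `ErratumRoadFive` (rung K2a), crux 6 = item 19065 `NonSurjCorner` — file 3: the corner's
# main-conjecture half in GROSS–ZAGIER currency, and the twin input as the X11a cell's object of record
# (cell `bsd-stepL`, seat `bsd-stepL-corner-p1` g0; `--supports stmt-BirchSwinnertonDyer-19065`)

HONEST FRAMING as in files 1–2 (`ErratumRoadFiveNonSurjCornerUpper/Lower.lean`): nothing here proves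
the crux; conditional kernel reductions only; nothing booked; X11b stays CONSTRUCTION-SHAPED. Files 1–2
gave `NonSurjCorner ⇐ EulerHalfOffLocus ∧ X11aLowerHalf ∧ published ∧ hA ∧ hT` with hA the corner open
input in the route's S0 currency (`IMCLowerWaldspurgerOnTreeAt`, the body of `OpenInputIMC` without
`Surj`) and hT the Euler-system half of the rank-`0` twin corner. This file records the same split in the
two OTHER currencies a supplier may deliver:

* §1–§2 **Gross–Zagier currency** (the Kolyvagin road's: `X11b.IndexLowerBoundAt W p K P`,
  `2·ord_p[E(K):ℤP] ≤ ord_p #Ш(E/K) + 2·ord_p ∏c`): STEP L at a datum ⟹ the half, with the twist's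
  Euler-system half in Miller's currency (`missingLowerBoundAt_of_indexLowerBoundAt_of_upperTwist`, data
  level, image-free), the class-level form at the Friedberg–Hoffstein ∕ Manin-good data
  (`missingLowerBoundAt_of_classX11b_of_indexLowerBoundNoSurj_of_upperTwist`), and the assembly
  `erratumRoadFive_nonSurjCorner_of_indexLowerBoundNoSurj_of_twinUpper`;
* §3 **the twin input as the X11a cell's object of record**: on the rank-`0` twin corner
  (`ClassX11a ∧ ¬Surj` ⊂ `X11a.Leaf`) the cell's typed input is Mazur's main conjecture at the pair,
  `X2.MazurMainConjectureAt Wd p`, whose glue `X11a.bsdp_of_mazurMainConjectureAt` (Stein–Wuthrich 2013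
  Thm. 6.1 + heights, Greenberg–Stevens, GZK, modularity — ANY image) gives `BSD(E^d,p)`, hence hT:
  `erratumRoadFive_nonSurjCorner_of_openInputNoSurj_of_twinMazurMC`. So the corner's residual reads:
  ONE anticyclotomic divisibility without `Surj` (hA) + Mazur's main conjecture on the X11a
  non-surjective leaf (rung K6's object), modulo cruxes 19062, 19064 and print.

References: [JetchevSkinnerWan2017] §7.4.1–7.4.2; [MatarNekovar2019] Thm. 0.3, §0.11; [Wuthrich2014]
Prop. 21; [SteinWuthrich2013] Thm. 6.1, §4.2; [Skinner2016PacificMC] Thm. A (shape of Mazur's MC at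
p ∥ N); [GreenbergStevens1993]; [FriedbergHoffstein1995] Thm. B; [Mazur1978] Cor. 4.1; [Miller2011LMS] Def. 1.1.
-/

noncomputable section

open scoped Classical

open WeierstrassCurve NumberField IsDedekindDomain Field
open Literature.NumberTheory.EllipticCurves Literature.NumberTheory.EllipticCurves.GreenbergSelmer
  Literature.NumberTheory.EllipticCurves.SteinWuthrich2013
  Literature.NumberTheory.EllipticCurves.ModularForms
  Literature.NumberTheory.EllipticCurves.Rank1Residual
  Literature.NumberTheory.EllipticCurves.Rank1Residual.Typed
  Literature.NumberTheory.EllipticCurves.Wuthrich2014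
  Literature.NumberTheory.EllipticCurves.BalakrishnanEtAl2019
  Literature.NumberTheory.QuadraticFields.Quadratic
  Literature.NumberTheory.Automorphic
  Literature.NumberTheory.GaloisRepresentations Literature.NumberTheory.GaloisCohomology
  Summit.BirchSwinnertonDyer.Rank1Residual.X11b.AcSelmer
  Summit.BirchSwinnertonDyer.Rank1Residual.X11b.LocBridge

namespace Summit.BirchSwinnertonDyer.Rank1Residual.X11b

open Summit.BirchSwinnertonDyer.BirchSwinnertonDyer.Theses.ErratumRoadFive

/-! ### §1. Gross–Zagier currency, data level -/

/-- **STEP L ⇒ the main-conjecture half, at fixed Heegner data, IMAGE-FREE: the twist's `≤`-half as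
a typed input** (multr1-p2's `missingLowerBoundAt_of_indexLowerBoundAt_of_surj` with Wuthrich 2014
Prop. 21 ∧ `Surj` replaced by `hup : Typed.MissingUpperBoundAt Wd p`). Data: `W/ℚ` globally minimal of
conductor `N`, `ord_{s=1} L(E,s) = 1`, `p ≥ 5` multiplicative for `E` with `E[p]` irreducible (any
image); `K` imaginary quadratic with the Heegner hypothesis for `N`, `p ∤ #𝓞_K^×`, `L(E^{d_K},1) ≠ 0`;
`P` the Heegner point of a datum `Dt` with `p ∤ c`; `Wd = Cd • W^{(d_K)}` globally minimal. PUBLISHED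
binders `hGZ`, `hKo`, `hGZK`, `hmod`; transports (a) multiplicative, (b) irreducible, (d)
`ord_p ∏c(Wd) = ord_p ∏c(W)` (`p ≥ 5`), (e) `ord_p u(Cd) = 0` are tree theorems. CONCLUSION:
`IndexLowerBoundAt W p K P → Typed.MissingLowerBoundAt W p`. CONDITIONAL on STEP L and on `hup`.
[cite: JetchevSkinnerWan2017, §7.4.1 (pp. 30–31)] [cite: Miller2011LMS, Def. 1.1] -/
theorem missingLowerBoundAt_of_indexLowerBoundAt_of_upperTwist
    (W : WeierstrassCurve ℚ) [W.IsElliptic] [W.IsGloballyMinimal] (p : ℕ) [Fact p.Prime]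
    [NeZero (W.conductorNorm ℤ)] (K : Type) [Field K] [NumberField K]
    (Dt : ModularParametrizationData W (W.conductorNorm ℤ))
    (H : HeegnerDatum (W.conductorNorm ℤ) (NumberField.discr K)) (ι : K →+* ℂ)
    (P : (W.baseChange K).toAffine.Point)
    -- the published inputs (named facts of the tree)
    (hGZ : gross_zagier (W.conductorNorm ℤ) W K) (hKo : kolyvagin (W.conductorNorm ℤ) W K)
    (hGZK : rank_eq_analyticRank_of_analyticRank_le_one) (hmod : hasEntireLFunction_rat)
    -- the pair
    (hr : W.analyticRank = 1) (hp5 : 5 ≤ p) (hmult : Mult W p) (hirr : Irr W p)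
    -- the Heegner data
    (hK : IsImaginaryQuadratic K) (hHN : SatisfiesHeegnerHypothesis (W.conductorNorm ℤ) K)
    (hP : WeierstrassCurve.Affine.Point.map ι.toRatAlgHom P = heegnerPointComplex Dt H)
    (hc : ¬ (p : ℤ) ∣ Dt.c) (hμ : ¬ p ∣ Units.torsionOrder K)
    (hLt : (W.quadraticTwist (NumberField.discr K : ℚ)).entireLFunction 1 ≠ 0)
    (Wd : WeierstrassCurve ℚ) [Wd.IsElliptic] [Wd.IsGloballyMinimal] (Cd : VariableChange ℚ)
    (hWd : Cd • W.quadraticTwist (NumberField.discr K : ℚ) = Wd)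
    -- the twist's Euler-system half (typed; Wuthrich 2014 Prop. 21 when `ρ̄_{E^d,p}` is onto)
    (hup : Typed.MissingUpperBoundAt Wd p)
    -- STEP L (the typed input of the route)
    (hL : IndexLowerBoundAt W p K P) :
    Typed.MissingLowerBoundAt W p := by
  have hp2 : p ≠ 2 := by omega
  have hD0 : (NumberField.discr K : ℚ) ≠ 0 := by exact_mod_cast NumberField.discr_ne_zero K
  haveI hEt : (W.quadraticTwist (NumberField.discr K : ℚ)).IsElliptic :=
    W.isElliptic_quadraticTwist hD0
  -- transports (a), (b), (d), (e) to the minimal twist model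
  have hirrd : Wd.HasIrreducibleModPGaloisRep p :=
    hasIrreducibleModPGaloisRep_twist_model W p K hK.1 hirr Cd hWd
  have htam : padicValNat p Wd.tamagawaProduct = padicValNat p W.tamagawaProduct :=
    padicValNat_tamagawaProduct_twist_of_heegner W p hp5 K hK hHN Cd hWd
  have hu : padicValRat p (Cd.u : ℚ) = 0 :=
    padicValRat_u_eq_zero_of_twist_minimal W p K hK hHN hmult Cd hWd
  -- the twist: `L(E^D,1) ≠ 0`, rank `0`, and its `≤`-half in print shape
  have hLt' : (W.quadraticTwist (NumberField.discr K : ℚ)).entireLFunction = Wd.entireLFunction := by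
    rw [← hWd, entireLFunction_smul]
  have hLd1 : Wd.entireLFunction 1 ≠ 0 := by rw [← hLt']; exact hLt
  have hrd : Wd.analyticRank = 0 := (Wd.analyticRank_eq_zero_iff_holds (hmod Wd)).2 hLd1
  have htw := exists_printShape_upper_of_missingUpperBoundAt_rankZero Wd p hGZK hrd hLd1 hirrd hup
  exact missingLowerBoundAt_of_indexLowerBoundAt W p (W.conductorNorm ℤ) K Dt H ι P hGZ hKo hGZK
    hmod hK hHN hP hp2 hc hμ hr hLt Wd Cd hWd hu htam htw (fun _ ↦ hL)

/-! ### §2. Gross–Zagier currency, class level and assembly -/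

/-- **The main-conjecture half at ONE X11b pair with `p ≥ 5`, ANY IMAGE, from STEP L in Gross–Zagier
currency at the Friedberg–Hoffstein ∕ Manin-good data of the pair (`hL`: `IndexLowerBoundAt W p K P` for
every imaginary quadratic `K` with `|d_K| > 4`, every `ℓ ∣ N` and `p` split, `L(E^{d_K},1) ≠ 0`, every
datum of level `N_E` with `p ∤ c` and its Heegner point `P` of infinite order) and the Euler-system half
of the NON-surjective rank-`0` Heegner twists (`hUtw`).** Chain of multr1-p2's
`missingLowerBoundAt_of_classX11b_of_surj` with Wuthrich 2014 Prop. 21 kept for a surjective twist and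
`hUtw` otherwise (`missingLowerBoundAt_of_indexLowerBoundAt_of_upperTwist`). CONDITIONAL on `hL`, `hUtw`.
[cite: Wuthrich2014, Prop. 21 (p. 400)] [cite: JetchevSkinnerWan2017, §7.4.1 (pp. 30–31)]
[cite: FriedbergHoffstein1995, Thm. B] [cite: Mazur1978, Cor. 4.1] [cite: Miller2011LMS, Def. 1.1] -/
theorem missingLowerBoundAt_of_classX11b_of_indexLowerBoundNoSurj_of_upperTwist
    (hGZ : ∀ (N : ℕ) [NeZero N] (W : WeierstrassCurve ℚ) (K : Type) [Field K] [NumberField K],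
      gross_zagier N W K)
    (hKo : ∀ (N : ℕ) [NeZero N] (W : WeierstrassCurve ℚ) (K : Type) [Field K] [NumberField K],
      kolyvagin N W K)
    (hWu : sha_dvd_analyticSha)
    (hGZK : rank_eq_analyticRank_of_analyticRank_le_one) (hmod : hasEntireLFunction_rat)
    (hnf : exists_isNewformOf) (hFHs : friedbergHoffstein_exists_heegnerField_split_twist_ne_zero)
    (hMaz : mazur_not_dvd_maninConstant_of_odd)
    (W : WeierstrassCurve ℚ) [W.IsElliptic] [W.IsGloballyMinimal] (p : ℕ) [Fact p.Prime]
    (hX : ClassX11b W p) (hp5 : 5 ≤ p)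
    -- STEP L in Gross–Zagier currency at the Friedberg–Hoffstein / Manin-good data of this pair
    (hL : ∀ (N : ℕ) [NeZero N] (K : Type) [Field K] [NumberField K]
      (Dt : ModularParametrizationData W N) (H : HeegnerDatum N (NumberField.discr K)) (ι : K →+* ℂ)
      (P : (W.baseChange K).toAffine.Point),
      W.conductorNorm ℤ = N → IsImaginaryQuadratic K → 4 < (NumberField.discr K).natAbs →
      SatisfiesHeegnerHypothesis N K → SatisfiesHeegnerHypothesis p K →
      (W.quadraticTwist (NumberField.discr K : ℚ)).entireLFunction 1 ≠ 0 →
      WeierstrassCurve.Affine.Point.map ι.toRatAlgHom P = heegnerPointComplex Dt H →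
      ¬ (p : ℤ) ∣ Dt.c → ¬ IsOfFinAddOrder P → IndexLowerBoundAt W p K P)
    -- the Euler-system half of the NON-surjective rank-`0` Heegner twists of this pair (typed)
    (hUtw : ∀ (K : Type) [Field K] [NumberField K]
      (Wd : WeierstrassCurve ℚ) [Wd.IsElliptic] [Wd.IsGloballyMinimal] (Cd : VariableChange ℚ),
      IsImaginaryQuadratic K → SatisfiesHeegnerHypothesis (W.conductorNorm ℤ) K →
      (W.quadraticTwist (NumberField.discr K : ℚ)).entireLFunction 1 ≠ 0 →
      Cd • W.quadraticTwist (NumberField.discr K : ℚ) = Wd → ¬ Surj Wd p →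
      Typed.MissingUpperBoundAt Wd p) :
    Typed.MissingLowerBoundAt W p := by
  have hNS : integral_neronScaling_of_isGloballyMinimal :=
    integral_neronScaling_of_isGloballyMinimal_holds
  have hp : p.Prime := Fact.out
  obtain ⟨hr, hp2, hmult, hirr⟩ := hX
  haveI : NeZero (W.conductorNorm ℤ) := ⟨(W.conductorNorm_pos_holds).ne'⟩
  -- the sign of the functional equation is `−1` (modularity, `r_an = 1`)
  have hw : W.rootNumber = -1 := by
    rw [WeierstrassCurve.rootNumber_eq_neg_one_pow_analyticRank_of_exists_isNewformOf hnf W, hr]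
    norm_num
  -- the Friedberg–Hoffstein field: every `ℓ ∣ N` and `p` split, `|d_K| > 4`, `L(E^{d_K},1) ≠ 0`
  obtain ⟨K, _, _, hK, hdisc, hHN, hHp, hLt⟩ := hFHs W hw p hp 4
  have hμ : ¬ p ∣ Units.torsionOrder K := by
    haveI : IsTotallyComplex K := hK.2
    have hneg : NumberField.discr K < 0 := discr_neg_of_finrank_eq_two K hK.1
    have habs : ((NumberField.discr K).natAbs : ℤ) = -NumberField.discr K :=
      Int.ofNat_natAbs_of_nonpos hneg.le
    have h4 : NumberField.discr K < -4 := by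
      have : (4 : ℤ) < ((NumberField.discr K).natAbs : ℤ) := by exact_mod_cast hdisc
      omega
    rw [Literature.NumberTheory.DiophantineGeometry.torsionOrder_eq_two_of_discr_lt hK.1 h4]
    intro h2
    have := Nat.le_of_dvd two_pos h2
    omega
  -- the Heegner datum with `p ∤ c` (modularity, Mazur 1978 Cor. 4.1, Néron mapping property)
  obtain ⟨Dt, H, ι, P, hP, hc⟩ :=
    exists_maninDatum hnf hMaz hNS W p (W.conductorNorm ℤ) K rfl hp5 hmult hirr hK hHN
  have hPinf : ¬ IsOfFinAddOrder P :=
    not_isOfFinAddOrder_of_heegner_of_analyticRank_eq_one W _ K Dt H ι P (hGZ _ W K) hmod hr hK hHN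
      hLt hP
  have hLd : IndexLowerBoundAt W p K P := hL _ K Dt H ι P rfl hK hdisc hHN hHp hLt hP hc hPinf
  -- a globally minimal model of the twist, transports, rank `0`
  have hD0 : (NumberField.discr K : ℚ) ≠ 0 := by exact_mod_cast NumberField.discr_ne_zero K
  haveI hEt : (W.quadraticTwist (NumberField.discr K : ℚ)).IsElliptic :=
    W.isElliptic_quadraticTwist hD0
  obtain ⟨Cd, hCd⟩ := hasGlobalMinimalModel_rat_holds (W.quadraticTwist (NumberField.discr K : ℚ))
  haveI : (Cd • W.quadraticTwist (NumberField.discr K : ℚ)).IsGloballyMinimal := hCd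
  set Wd : WeierstrassCurve ℚ := Cd • W.quadraticTwist (NumberField.discr K : ℚ) with hWd_def
  have hWd : Cd • W.quadraticTwist (NumberField.discr K : ℚ) = Wd := rfl
  by_cases hsd : Surj Wd p
  · -- surjective twist: Wuthrich 2014 Prop. 21 gives its `≤`-half in print shape
    have hmultd : Wd.HasMultiplicativeReductionAtPrime p :=
      hasMultiplicativeReductionAtPrime_twist_of_heegner' W p K hK hHN hmult Cd hWd
    have htam : padicValNat p Wd.tamagawaProduct = padicValNat p W.tamagawaProduct :=
      padicValNat_tamagawaProduct_twist_of_heegner W p hp5 K hK hHN Cd hWd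
    have hu : padicValRat p (Cd.u : ℚ) = 0 :=
      padicValRat_u_eq_zero_of_twist_minimal W p K hK hHN hmult Cd hWd
    have hLt' : (W.quadraticTwist (NumberField.discr K : ℚ)).entireLFunction = Wd.entireLFunction := by
      rw [← hWd, entireLFunction_smul]
    have hLd1 : Wd.entireLFunction 1 ≠ 0 := by rw [← hLt']; exact hLt
    have htw := twist_le_half_of_wuthrich hWu hGZK hmod Wd p hp2 hLd1 hmultd hsd
    exact missingLowerBoundAt_of_indexLowerBoundAt W p _ K Dt H ι P (hGZ _ W K) (hKo _ W K) hGZK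
      hmod hK hHN hP hp2 hc hμ hr hLt Wd Cd hWd hu htam htw (fun _ ↦ hLd)
  · exact missingLowerBoundAt_of_indexLowerBoundAt_of_upperTwist W p K Dt H ι P (hGZ _ W K)
      (hKo _ W K) hGZK hmod hr hp5 hmult hirr hK hHN hP hc hμ hLt Wd Cd hWd
      (hUtw K Wd Cd hK hHN hLt hWd hsd) hLd

/-- **Crux `NonSurjCorner` (item 19065) ⇐ STEP L in GROSS–ZAGIER currency on the corner (`hL`) + the
twin corner's Euler-system half (`hT`) + cruxes `EulerHalfOffLocus` (19062), `X11aLowerHalf` (19064) +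
published facts** (Gross–Zagier, Kolyvagin, Wuthrich 2014 Prop. 21, Matar–Nekovář 2019, GZK, modularity
×2, Friedberg–Hoffstein, Mazur 1978 Cor. 4.1). `hL` = `IndexLowerBoundAt W p K P` at every
Friedberg–Hoffstein ∕ Manin-good datum of a corner pair — the currency a Kolyvagin-system supplier
delivers (McCallum's `ord_p #Ш(E/K) = 2(M₀ − M_∞)`; every printed one needs `ρ̄` onto: W. Zhang 2014,
Skinner–Zhang 2014, Sweeting 2020); `hT` as in file 2. Upper half: file 1. CONDITIONAL on `hL`, `hT`,
`h₂`, `h₄`; does NOT close item 19065; nothing booked. [cite: JetchevSkinnerWan2017, §7.4.1–7.4.2 (pp. 30–31)]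
[cite: MatarNekovar2019, Thm. 0.3 (p. 456) and §0.11 (p. 457)] [cite: Wuthrich2014, Prop. 21 (p. 400)]
[cite: McCallumLMS1991, §5 Cor. 5.6 (shape of a supplier; nothing asserted)] [cite: Miller2011LMS, Def. 1.1] -/
theorem erratumRoadFive_nonSurjCorner_of_indexLowerBoundNoSurj_of_twinUpper
    (hGZ : ∀ (N : ℕ) [NeZero N] (W : WeierstrassCurve ℚ) (K : Type) [Field K] [NumberField K],
      gross_zagier N W K)
    (hKo : ∀ (N : ℕ) [NeZero N] (W : WeierstrassCurve ℚ) (K : Type) [Field K] [NumberField K],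
      kolyvagin N W K)
    (hWu : sha_dvd_analyticSha)
    (hMN : ∀ (N : ℕ) [NeZero N] (W : WeierstrassCurve ℚ) (K : Type) [Field K] [NumberField K],
      MatarNekovar2019.thm03_padicValNat_card_sha_le_of_irreducible N W K)
    (hGZK : rank_eq_analyticRank_of_analyticRank_le_one) (hmod : hasEntireLFunction_rat)
    (hnf : exists_isNewformOf) (hFHs : friedbergHoffstein_exists_heegnerField_split_twist_ne_zero)
    (hMaz : mazur_not_dvd_maninConstant_of_odd)
    (h₂ : Summit.BirchSwinnertonDyer.BirchSwinnertonDyer.Theses.ErratumRoadFive.EulerHalfOffLocus)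
    (h₄ : Summit.BirchSwinnertonDyer.BirchSwinnertonDyer.Theses.ErratumRoadFive.X11aLowerHalf)
    -- residual 1′: STEP L in Gross–Zagier currency on the corner
    (hL : ∀ (W : WeierstrassCurve ℚ) [W.IsElliptic] [W.IsGloballyMinimal] (p : ℕ) [Fact p.Prime]
      (N : ℕ) [NeZero N] (K : Type) [Field K] [NumberField K]
      (Dt : ModularParametrizationData W N) (H : HeegnerDatum N (NumberField.discr K)) (ι : K →+* ℂ)
      (P : (W.baseChange K).toAffine.Point),
      ClassX11b W p → ¬ Surj W p → (p = 5 ∨ p = 7) → p ∣ padicValInt p W.minimalDiscriminantInt →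
      ¬ Ram W p → W.conductorNorm ℤ = N → IsImaginaryQuadratic K →
      4 < (NumberField.discr K).natAbs → SatisfiesHeegnerHypothesis N K →
      SatisfiesHeegnerHypothesis p K →
      (W.quadraticTwist (NumberField.discr K : ℚ)).entireLFunction 1 ≠ 0 →
      WeierstrassCurve.Affine.Point.map ι.toRatAlgHom P = heegnerPointComplex Dt H →
      ¬ (p : ℤ) ∣ Dt.c → ¬ IsOfFinAddOrder P → IndexLowerBoundAt W p K P)
    -- residual 2: the Euler-system half on the rank-`0` TWIN corner (X11a ∧ ¬Surj, localised)
    (hT : ∀ (Wd : WeierstrassCurve ℚ) [Wd.IsElliptic] [Wd.IsGloballyMinimal] (p : ℕ) [Fact p.Prime],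
      ClassX11a Wd p → ¬ Surj Wd p → (p = 5 ∨ p = 7) →
      p ∣ padicValInt p Wd.minimalDiscriminantInt → Typed.MissingUpperBoundAt Wd p) :
    Summit.BirchSwinnertonDyer.BirchSwinnertonDyer.Theses.ErratumRoadFive.NonSurjCorner := by
  intro W _ _ p _ hX hns h57 hv hnr
  have hp5 : 5 ≤ p := by rcases h57 with h | h <;> omega
  refine Typed.missingPPartAt_of_lower_of_upper W p ?_
    (erratumRoadFive_nonSurjCorner_upperHalf hGZ hKo hMN hGZK hmod hnf hFHs hMaz h₂ h₄ W p hX hns h57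
      hv hnr)
  refine missingLowerBoundAt_of_classX11b_of_indexLowerBoundNoSurj_of_upperTwist hGZ hKo hWu hGZK
    hmod hnf hFHs hMaz W p hX hp5
    (fun N _ K _ _ Dt H ι P hN hK hdisc hHN hHp hLt hP hc hPinf ↦
      hL W p N K Dt H ι P hX hns h57 hv hnr hN hK hdisc hHN hHp hLt hP hc hPinf) ?_
  intro K _ _ Wd _ _ Cd hK hHN hLt hWd hnsd
  have hD0 : (NumberField.discr K : ℚ) ≠ 0 := by exact_mod_cast NumberField.discr_ne_zero K
  haveI : (W.quadraticTwist (NumberField.discr K : ℚ)).IsElliptic := W.isElliptic_quadraticTwist hD0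
  have hrd : Wd.analyticRank = 0 := by
    rw [← hWd, analyticRank_smul]
    exact analyticRank_eq_zero_of_entireLFunction_one_ne_zero _ hLt
  have hXa : ClassX11a Wd p := classX11a_twist_of_not_ram W p hX hnr K hK hHN Cd hWd hrd
  have hpN : p ∣ W.conductorNorm ℤ := dvd_conductorNorm_of_mult hX.2.2.1
  have hsq := isSquare_discr_padic_of_heegner K hK hHN p hpN
  have hvd : p ∣ padicValInt p Wd.minimalDiscriminantInt := by
    rw [padicValInt_minimalDiscriminantInt_twist_eq W p hD0 hsq Cd hWd]
    exact hv
  exact hT Wd p hXa hnsd h57 hvd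

/-! ### §3. The twin input as the X11a cell's object of record: Mazur's main conjecture at the twin pair -/

/-- **Mazur's main conjecture at an X11a pair ⇒ its Euler-system half** (any image): the X11a cell's
glue `X11a.bsdp_of_mazurMainConjectureAt` (PUBLISHED binders Stein–Wuthrich 2013 Thm. 6.1 `hJs`/`hJn` with
THE §4.2 heights `hHs`/`hHn`, Greenberg–Stevens `hGS`, GZK, modularity `hmod`/`hpar`) gives `BSD(E^d,p)`,
whence both Miller halves (`Typed.missingPPartAt_of_bsdp`, `Typed.lower_and_upper_of_missingPPartAt`).
CONDITIONAL on `hMC`. [cite: SteinWuthrich2013, Thm. 6.1 (p. 20) and §4.2]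
[cite: Skinner2016PacificMC, Thm. A (§1) (shape of hMC; nothing asserted)] [cite: Miller2011LMS, Def. 1.1] -/
theorem missingUpperBoundAt_of_classX11a_of_mazurMainConjectureAt
    (hJs : thm61_splitMultiplicative) (hJn : thm61_nonsplitMultiplicative)
    (hHs : exists_isSplitMultCanonical) (hHn : exists_isMultCanonical)
    (hGZK : rank_eq_analyticRank_of_analyticRank_le_one) (hmod : hasEntireLFunction_rat)
    (hpar : nonempty_modularParametrizationData)
    (Wd : WeierstrassCurve ℚ) [Wd.IsElliptic] [Wd.IsGloballyMinimal] (p : ℕ) [Fact p.Prime]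
    (hGS : greenberg_stevens (W := Wd) (p := p))
    (hXa : ClassX11a Wd p) (hMC : X2.MazurMainConjectureAt Wd p) :
    Typed.MissingUpperBoundAt Wd p := by
  have hb : BSDp Wd p := X11a.bsdp_of_mazurMainConjectureAt hJs hJn hHs hHn hGZK hmod hpar hGS hXa hMC
  haveI : Finite Wd.sha := (hGZK Wd (by rw [hXa.1]; exact zero_le_one)).2
  exact (Typed.lower_and_upper_of_missingPPartAt Wd p (Typed.missingPPartAt_of_bsdp Wd p hb)).2

/-- **Crux `NonSurjCorner` (item 19065) ⇐ the corner open input (`hA`, file 2) + MAZUR'S MAIN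
CONJECTURE ON THE RANK-`0` TWIN CORNER (`hMC`: `X2.MazurMainConjectureAt Wd p` for every X11a pair with
`¬ Surj`, `p ∈ {5,7}`, `p ∣ ord_p Δ_min` — the X11a cell's typed input of record on its non-surjective
leaf, rung K6's object) + cruxes 19062, 19064 + published facts** (file 2's eleven + Stein–Wuthrich 2013
Thm. 6.1 ×2 with heights ×2, Greenberg–Stevens, the parametrisation fact). File 2's
`erratumRoadFive_nonSurjCorner_of_openInputNoSurj_of_twinUpper` with hT supplied by
`missingUpperBoundAt_of_classX11a_of_mazurMainConjectureAt`. CONDITIONAL on `hA`, `hMC`, `h₂`, `h₄`;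
does NOT close item 19065; nothing booked. [cite: SteinWuthrich2013, Thm. 6.1 (p. 20)]
[cite: Castella2018, Thm. 3.2 (arXiv:1704.06608 p. 9) (shape of hA; nothing asserted)]
[cite: MatarNekovar2019, Thm. 0.3 (p. 456) and §0.11 (p. 457)] [cite: Miller2011LMS, Def. 1.1] -/
theorem erratumRoadFive_nonSurjCorner_of_openInputNoSurj_of_twinMazurMC
    (hGZ : ∀ (N : ℕ) [NeZero N] (W : WeierstrassCurve ℚ) (K : Type) [Field K] [NumberField K],
      gross_zagier N W K)
    (hKo : ∀ (N : ℕ) [NeZero N] (W : WeierstrassCurve ℚ) (K : Type) [Field K] [NumberField K],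
      kolyvagin N W K)
    (hWu : sha_dvd_analyticSha)
    (hMN : ∀ (N : ℕ) [NeZero N] (W : WeierstrassCurve ℚ) (K : Type) [Field K] [NumberField K],
      MatarNekovar2019.thm03_padicValNat_card_sha_le_of_irreducible N W K)
    (hGZK : rank_eq_analyticRank_of_analyticRank_le_one) (hmod : hasEntireLFunction_rat)
    (hnf : exists_isNewformOf) (hHL : HoffsteinLuo1997_exists_twist_L_one_ne_zero)
    (hFHs : friedbergHoffstein_exists_heegnerField_split_twist_ne_zero)
    (hMaz : mazur_not_dvd_maninConstant_of_odd)
    (hPT : ∀ (K : Type) [Field K] [NumberField K], poitouTate_sum_localTatePairing_eq_zero K)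
    (hEP : ∀ (K : Type) [Field K] [NumberField K] (v : HeightOneSpectrum (𝓞 K)),
      localEulerPoincareCharacteristic (v.adicCompletion K))
    (hJs : thm61_splitMultiplicative) (hJn : thm61_nonsplitMultiplicative)
    (hHs : exists_isSplitMultCanonical) (hHn : exists_isMultCanonical)
    (hpar : nonempty_modularParametrizationData)
    (hGS : ∀ (W : WeierstrassCurve ℚ) [W.IsElliptic] [W.IsGloballyMinimal] (p : ℕ) [Fact p.Prime],
      greenberg_stevens (W := W) (p := p))
    (h₂ : Summit.BirchSwinnertonDyer.BirchSwinnertonDyer.Theses.ErratumRoadFive.EulerHalfOffLocus)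
    (h₄ : Summit.BirchSwinnertonDyer.BirchSwinnertonDyer.Theses.ErratumRoadFive.X11aLowerHalf)
    -- residual 1: THE open input of the route ON THE CORNER (`P2OpenInputOnTreeAt` with `¬ Surj`)
    (hA : ∀ (W : WeierstrassCurve ℚ) [W.IsElliptic] [W.IsGloballyMinimal] (p : ℕ) [Fact p.Prime]
      (N : ℕ) [NeZero N] (K : Type) [Field K] [NumberField K]
      (Dt : ModularParametrizationData W N) (H : HeegnerDatum N (NumberField.discr K)) (ι : K →+* ℂ)
      (P : (W.baseChange K).toAffine.Point),
      ClassX11b W p → ¬ Surj W p → (p = 5 ∨ p = 7) → p ∣ padicValInt p W.minimalDiscriminantInt →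
      ¬ Ram W p → W.conductorNorm ℤ = N → IsImaginaryQuadratic K →
      Odd (NumberField.discr K) → ¬ (p : ℤ) ∣ NumberField.discr K → ¬ p ∣ Units.torsionOrder K →
      SatisfiesHeegnerHypothesis N K →
      (W.quadraticTwist (NumberField.discr K : ℚ)).entireLFunction 1 ≠ 0 →
      WeierstrassCurve.Affine.Point.map ι.toRatAlgHom P = heegnerPointComplex Dt H →
      ¬ (p : ℤ) ∣ Dt.c → ¬ IsOfFinAddOrder P →
      ∀ (κ : ZpExtension K p), κ.IsAnticyclotomic →
        ∀ (γ : Field.absoluteGaloisGroup K) [Fact (κ.IsTopGenerator γ)]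
          (𝔭 : HeightOneSpectrum (𝓞 K)) (h𝔭 : ((p : ℕ) : 𝓞 K) ∈ 𝔭.asIdeal)
          (he : 𝔭.asIdeal.ramificationIdx (𝓞 ℚ) = 1) (hf : 𝔭.asIdeal.inertiaDeg (𝓞 ℚ) = 1),
          IMCLowerWaldspurgerOnTreeAt p κ 𝔭 γ (embAt K p 𝔭 h𝔭 he hf) P)
    -- residual 2″: Mazur's main conjecture on the rank-`0` TWIN corner (X11a ∧ ¬Surj, localised)
    (hMC : ∀ (Wd : WeierstrassCurve ℚ) [Wd.IsElliptic] [Wd.IsGloballyMinimal] (p : ℕ) [Fact p.Prime],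
      ClassX11a Wd p → ¬ Surj Wd p → (p = 5 ∨ p = 7) →
      p ∣ padicValInt p Wd.minimalDiscriminantInt → X2.MazurMainConjectureAt Wd p) :
    Summit.BirchSwinnertonDyer.BirchSwinnertonDyer.Theses.ErratumRoadFive.NonSurjCorner :=
  erratumRoadFive_nonSurjCorner_of_openInputNoSurj_of_twinUpper hGZ hKo hWu hMN hGZK hmod hnf hHL hFHs
    hMaz hPT hEP h₂ h₄ hA
    (fun Wd _ _ p _ hXa hnsd h57 hvd ↦
      missingUpperBoundAt_of_classX11a_of_mazurMainConjectureAt hJs hJn hHs hHn hGZK hmod hpar Wd p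
        (hGS Wd p) hXa (hMC Wd p hXa hnsd h57 hvd))

end Summit.BirchSwinnertonDyer.Rank1Residual.X11b

end
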